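import Summits.AtomisticToContinuum.Crystallization.Theorems.ReggeStarCoercivityDefectFreeCrystallizesPalmDefs
import Summits.AtomisticToContinuum.Crystallization.Theorems.ReggeStarCoercivityDefectFreeCrystallizesFunnelFiniteGap
import Summits.AtomisticToContinuum.Crystallization.Theorems.MinimiserShells.Negative.LoadBearing
import Summits.AtomisticToContinuum.Crystallization.Theorems.MinimiserShells.Negative.Rootedness
import Summits.AtomisticToContinuum.Crystallization.Theorems.ChargedEnergyGap.Negative.PeriodicFormConverse
import Summits.AtomisticToContinuum.Crystallization.Theorems.PalmUnimodularRigidityMinimiserShellsDeepBadPricingOfShellNoBoundary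
import Summits.AtomisticToContinuum.Crystallization.Theorems.PalmUnimodularRigidityLayeredLawsSelectHcpPeriodicMuGSC
import Summits.AtomisticToContinuum.Crystallization.Theorems.PalmUnimodularRigidityMinimiserShellsPeriodicShellGapOfQualShellNoBoundary

/-!
# The funnel finite gap gives the funnel periodic shell gap (stub F14 of line `palm-good-law`, crux stmt-AtomisticToContinuum-13603)

Stub `stub_funnelPeriodicShellGap_of_funnelFiniteGap` of the lead-c2 skeleton `Cruxes/DefectFreeCrystallizes/Lines/palm_good_law.lean`
(canonicity of the reshape: together with the landed F13 the CORE funnel periodic shell gap is EQUIVALENT to the funnel finite gap).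
Template: 9225's S14 `Theorems/PalmUnimodularRigidityMinimiserShellsPeriodicShellGapOfQualShellNoBoundary.lean`
(`PeriodicShellGapConverse.stub_periodicShellGap_of_qualShellNoBoundary`: `K³`-blocks of `Q`, `image_sub_bpt_points`,
`points_inter_closedBall_subset_range`, `goodShell_block_iff`, `card_bad_block_ge`); the one new ingredient is the locality of
`SetGood` for deep block points (`FunnelFiniteGap.setGood_congr_of_closedBall`, radius `6/5 < 3/2`) and the count of non-`SetGood`
block points `≤ #nonSetGood(F)·K³ + #F·6·depth·K²`.

If the FUNNEL FINITE gap holds — for every threshold `t > 0` some `κ > 0` and budget `s > 0` such that every finite injective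
configuration `y : Fin N → ℝ³` with at most `s · N` indices not `SetGood` in `range y` and at least `t · N` badly-shelled
indices has `N · (e* + κ) ≤ 𝓔_N(y)` — then the FUNNEL PERIODIC shell gap holds: for every `t > 0`, with the finite `(κ, s)` of
threshold `t/2` and the budget `s/2`, every periodic configuration `Q` of `ℝ³` with at most `(s/2) · #motif` motif sites not
`SetGood` in `Q.points` and at least `t · #motif` motif sites badly shelled in `Q.points` has `e* + κ ≤ e(Q)`.

Proof.  Fix such a `Q` and `ε > 0`; it suffices to show `e* + κ ≤ e(Q) + ε`.  The `K³`-blocks `blockConfig Q K` of `Q` are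
injective with energy `≤ #F·K³·(e(Q) + ε)` for `K ≥ K₀(ε)` (`Blocks.exists_block_energy_le`).  A block point `x + g` with
`depth Q 2`-deep lattice coordinates is badly shelled in the block iff `x` is badly shelled in `Q.points` (`goodShell_block_iff`),
and — since `SetGood` only reads the open ball of radius `6/5 ≤ 3/2` about the point (`setGood_congr_of_closedBall`,
`points_inter_closedBall_subset_range`) and `Q.points` re-rooted at `x + g` is `Q.points` re-rooted at `x`
(`image_sub_bpt_points`, `setGood_image_sub_zero_iff`) — it is `SetGood` in the block iff `x` is `SetGood` in `Q.points`
(`setGood_block_iff`).  All but `≤ 6·depth·K²` coordinates are deep (`Blocks.card_deep_ge`, `Blocks.card_not_deep_le`), so for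
`K ≥ 12·depth` the block has `≥ (t/2) · #F·K³` badly-shelled sites (`card_bad_block_ge`) and, for `s·K ≥ 12·depth`, at most
`(s/2)·#F·K³ + 6·depth·K²·#F ≤ s · #F·K³` sites not `SetGood` (`card_notSetGood_block_le`); the finite gap at threshold `t/2`
gives `#F·K³ · (e* + κ) ≤ 𝓔(block) ≤ #F·K³ · (e(Q) + ε)`.
-/

noncomputable section

open MeasureTheory
open scoped ENNReal BigOperators Classical

namespace Summit.AtomisticToContinuum.Crystallization.Theorems.PalmGoodLaw.FunnelPeriodicGapConverse

open Literature.MathematicalPhysics.StatisticalMechanics (lennardJones interactionEnergy PeriodicConfiguration)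
open Summit.AtomisticToContinuum.Crystallization.Theorems.MinimiserShells.Negative.LoadBearing (eStar GoodShell)
open Summit.AtomisticToContinuum.Crystallization.Theorems.MinimiserShells.Negative.Rootedness (E3)
open Summit.AtomisticToContinuum.Crystallization.Theorems.PalmUnimodularRigidityMinimiserShells.ShellNoBoundary
  (goodShell_count_restrict_image_sub_congr)
open Summit.AtomisticToContinuum.Crystallization.Theorems.ChargedEnergyGapNegative.Blocks
  (BIdx bpt card_BIdx blockConfig blockConfig_apply blockConfig_injective toP
   IsDeep depth exists_eq_toP_of_dist_lt exists_block_energy_le card_deep_ge card_not_deep_le latVec latVec_mem coords)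
open Summit.AtomisticToContinuum.Crystallization.Theorems.PalmUnimodularRigidity.LayeredLawsSelectHcp
  (range_blockConfig_subset bpt_mem_range_blockConfig)
open Summit.AtomisticToContinuum.Crystallization.Theorems.PalmUnimodularRigidityMinimiserShells.PeriodicShellGapConverse
  (image_sub_bpt_points points_inter_closedBall_subset_range goodShell_block_iff card_bad_block_ge)
open Summit.AtomisticToContinuum.Crystallization.Theorems.PalmGoodLaw.FunnelFiniteGap (setGood_congr_of_closedBall)

variable (Q : PeriodicConfiguration 3) (K : ℕ)

/-! ## `SetGood` at block points -/

/-- **Re-rooting.**  `y` is `SetGood` in `S` iff the origin is `SetGood` in the re-rooted set `S - y`: the punctured open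
balls of radius `6/5` correspond under `z ↦ z - y`, and the recentred rescaled shells coincide. [folklore] -/
theorem setGood_image_sub_zero_iff (S : Set E3) (y : E3) :
    SetGood ((fun z : E3 => z - y) '' S) 0 ↔ SetGood S y := by
  have hset : ∀ a : ℝ, (fun z : E3 => a⁻¹ • (z - 0)) ''
        {z : E3 | z ∈ (fun z : E3 => z - y) '' S ∧ z ≠ 0 ∧ dist z 0 < 6 / 5} =
      (fun z : E3 => a⁻¹ • (z - y)) '' {z : E3 | z ∈ S ∧ z ≠ y ∧ dist z y < 6 / 5} := by
    intro a
    ext t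
    simp only [Set.mem_image, Set.mem_setOf_eq, sub_zero, dist_zero_right]
    constructor
    · rintro ⟨z, ⟨⟨w, hw, rfl⟩, hne, hlt⟩, rfl⟩
      exact ⟨w, ⟨hw, fun h => hne (by rw [h, sub_self]), by rwa [dist_eq_norm]⟩, rfl⟩
    · rintro ⟨w, ⟨hw, hne, hlt⟩, rfl⟩
      exact ⟨w - y, ⟨⟨w, hw, rfl⟩, sub_ne_zero.2 hne, by rwa [← dist_eq_norm]⟩, rfl⟩
  unfold SetGood
  refine exists_congr fun a => ?_
  rw [hset a]

/-- **Lattice invariance of `SetGood` in `Q.points`.**  The block point `x + g` (`g = latVec Q (coords K k)` a period) is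
`SetGood` in `Q.points` iff the motif point `x` is: both read the origin of the same re-rooted set
(`image_sub_bpt_points`). [folklore] -/
theorem setGood_points_bpt_iff (u : BIdx Q K) :
    SetGood Q.points (bpt Q K u) ↔ SetGood Q.points (u.1 : E3) := by
  rw [← setGood_image_sub_zero_iff Q.points (bpt Q K u), image_sub_bpt_points,
    setGood_image_sub_zero_iff]

/-- **Deep block points are `SetGood` in the block iff their motif point is `SetGood` in `Q`.**  For `depth Q 2`-deep
lattice coordinates, every point of `Q` within `3/2` of the block point is a block point
(`points_inter_closedBall_subset_range`), and `SetGood` only reads the open ball of radius `6/5 ≤ 3/2`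
(`setGood_congr_of_closedBall`); then lattice invariance (`setGood_points_bpt_iff`). [folklore] -/
theorem setGood_block_iff {u : BIdx Q K} (hdeep : IsDeep K (depth Q 2) u.2) :
    SetGood (Set.range (blockConfig Q K)) (bpt Q K u) ↔ SetGood Q.points (u.1 : E3) := by
  rw [← setGood_points_bpt_iff Q K u]
  exact (setGood_congr_of_closedBall (range_blockConfig_subset Q K)
    (by norm_num : (6 : ℝ) / 5 ≤ 3 / 2)
    (points_inter_closedBall_subset_range Q K (u := u) hdeep)).symm

/-! ## Counting block points that are not `SetGood` -/

/-- **Non-`SetGood` block points are few**: a block index not `SetGood` in the block has a motif point not `SetGood` in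
`Q.points` or non-deep lattice coordinates (`setGood_block_iff`), so there are at most
`#{x ∈ F not SetGood} · K³ + #F · 6·depth·K²` of them (`Blocks.card_not_deep_le`). [folklore] -/
theorem card_notSetGood_block_le :
    Nat.card {a : Fin (Fintype.card (BIdx Q K)) //
        ¬ SetGood (Set.range (blockConfig Q K)) (blockConfig Q K a)} ≤
      Nat.card {x : Q.motif // ¬ SetGood Q.points (x : E3)} * K ^ 3 +
        Q.motif.card * (6 * depth Q 2 * K ^ 2) := by
  classical
  -- (1) re-index by `BIdx`: a non-`SetGood` block point has a non-`SetGood` motif point or non-deep coordinates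
  have h1 : Nat.card {a : Fin (Fintype.card (BIdx Q K)) //
        ¬ SetGood (Set.range (blockConfig Q K)) (blockConfig Q K a)} ≤
      Nat.card {u : BIdx Q K // ¬ SetGood Q.points (u.1 : E3) ∨ ¬ IsDeep K (depth Q 2) u.2} := by
    refine Nat.card_le_card_of_injective
      (fun a => (⟨(Fintype.equivFin (BIdx Q K)).symm a.1, by
          by_contra h
          rw [not_or, not_not, not_not] at h
          exact a.2 (by
            rw [blockConfig_apply]
            exact (setGood_block_iff Q K h.2).2 h.1)⟩ :
        {u : BIdx Q K // ¬ SetGood Q.points (u.1 : E3) ∨ ¬ IsDeep K (depth Q 2) u.2})) ?_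
    intro a b hab
    exact Subtype.ext ((Fintype.equivFin (BIdx Q K)).symm.injective (congrArg Subtype.val hab))
  -- (2) split the disjunction
  have h2 : Nat.card {u : BIdx Q K // ¬ SetGood Q.points (u.1 : E3) ∨ ¬ IsDeep K (depth Q 2) u.2} ≤
      Nat.card {u : BIdx Q K // ¬ SetGood Q.points (u.1 : E3)} +
        Nat.card {u : BIdx Q K // ¬ IsDeep K (depth Q 2) u.2} := by
    rw [← Nat.card_sum]
    exact Nat.card_le_card_of_injective _ (subtypeOrLeftEmbedding _ _).injective
  -- (3) the first summand: `(u ↦ (motif point, coordinates))` injects into `{x not SetGood} × (Fin 3 → Fin K)`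
  have h3 : Nat.card {u : BIdx Q K // ¬ SetGood Q.points (u.1 : E3)} ≤
      Nat.card {x : Q.motif // ¬ SetGood Q.points (x : E3)} * K ^ 3 := by
    have e : Nat.card (Fin 3 → Fin K) = K ^ 3 := by
      rw [Nat.card_fun, Nat.card_fin, Nat.card_fin]
    rw [← e, ← Nat.card_prod]
    refine Nat.card_le_card_of_injective
      (fun u => ((⟨u.1.1, u.2⟩ : {x : Q.motif // ¬ SetGood Q.points (x : E3)}), u.1.2)) ?_
    intro u v h
    dsimp only at h
    obtain ⟨h₁, h₂⟩ := Prod.mk.inj h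
    exact Subtype.ext (Prod.ext (congrArg Subtype.val h₁) h₂)
  -- (4) the second summand: `(u ↦ (motif point, coordinates))` injects into `F × {k not deep}`
  have h4 : Nat.card {u : BIdx Q K // ¬ IsDeep K (depth Q 2) u.2} ≤
      Q.motif.card * (6 * depth Q 2 * K ^ 2) := by
    have hk : Nat.card {k : Fin 3 → Fin K // ¬ IsDeep K (depth Q 2) k} =
        (Finset.univ.filter fun k : Fin 3 → Fin K => ¬ IsDeep K (depth Q 2) k).card :=
      Nat.subtype_card _ fun k => by simp only [Finset.mem_filter, Finset.mem_univ, true_and]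
    have hk' : Nat.card {k : Fin 3 → Fin K // ¬ IsDeep K (depth Q 2) k} ≤ 6 * depth Q 2 * K ^ 2 :=
      hk.trans_le (card_not_deep_le K (depth Q 2))
    have hF : Nat.card Q.motif = Q.motif.card := Nat.card_eq_finsetCard _
    calc Nat.card {u : BIdx Q K // ¬ IsDeep K (depth Q 2) u.2}
        ≤ Nat.card (Q.motif × {k : Fin 3 → Fin K // ¬ IsDeep K (depth Q 2) k}) :=
          Nat.card_le_card_of_injective
            (fun u => (u.1.1, (⟨u.1.2, u.2⟩ : {k : Fin 3 → Fin K // ¬ IsDeep K (depth Q 2) k})))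
            (fun u v h => by
              dsimp only at h
              obtain ⟨h₁, h₂⟩ := Prod.mk.inj h
              exact Subtype.ext (Prod.ext h₁ (congrArg Subtype.val h₂)))
      _ = Q.motif.card * Nat.card {k : Fin 3 → Fin K // ¬ IsDeep K (depth Q 2) k} := by
          rw [Nat.card_prod, hF]
      _ ≤ Q.motif.card * (6 * depth Q 2 * K ^ 2) := Nat.mul_le_mul_left _ hk'
  exact h1.trans (h2.trans (add_le_add h3 h4))

/-! ## The stub -/

/-- **Stub `stub_funnelPeriodicShellGap_of_funnelFiniteGap` (F14) of line `palm-good-law`.**  The funnel finite gap implies the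
funnel periodic shell gap (threshold `t` from the finite statement at `t/2`, same `κ`, half the budget): the `K³`-blocks of `Q`
are trial states (`Blocks.exists_block_energy_le`); their deep block points are badly shelled, resp. `SetGood`, in the block iff
their motif point is so in `Q.points` (`goodShell_block_iff`, `setGood_block_iff`), so for `K` large they have
`≥ (t/2)·#F·K³` badly-shelled sites (`card_bad_block_ge`) and `≤ s·#F·K³` sites not `SetGood` (`card_notSetGood_block_le`), and
the finite gap gives `e* + κ ≤ e(Q) + ε` for every `ε > 0`. [folklore] -/
theorem stub_funnelPeriodicShellGap_of_funnelFiniteGap :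
    (∀ t : ℝ, 0 < t → ∃ κ : ℝ, 0 < κ ∧ ∃ s : ℝ, 0 < s ∧
      ∀ (N : ℕ) (y : Fin N → EuclideanSpace ℝ (Fin 3)), Function.Injective y →
        (Nat.card {i : Fin N // ¬ SetGood (Set.range y) (y i)} : ℝ) ≤ s * (N : ℝ) →
        t * (N : ℝ) ≤ (Nat.card {i : Fin N // ¬ GoodShell
            ((Measure.count : Measure (EuclideanSpace ℝ (Fin 3))).restrict ((fun z => z - y i) '' Set.range y))} : ℝ) →
        (N : ℝ) * (eStar + κ) ≤ interactionEnergy lennardJones y) →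
    ∀ t : ℝ, 0 < t → ∃ κ : ℝ, 0 < κ ∧ ∃ s : ℝ, 0 < s ∧
      ∀ Q : Literature.MathematicalPhysics.StatisticalMechanics.PeriodicConfiguration 3,
        (Nat.card {x : Q.motif // ¬ SetGood Q.points (x : EuclideanSpace ℝ (Fin 3))} : ℝ) ≤
            s * (Q.motif.card : ℝ) →
        t * (Q.motif.card : ℝ) ≤ (Nat.card {x : Q.motif // ¬ GoodShell
            ((Measure.count : Measure (EuclideanSpace ℝ (Fin 3))).restrict
              ((fun z => z - (x : EuclideanSpace ℝ (Fin 3))) '' Q.points))} : ℝ) →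
        eStar + κ ≤ Q.energyPerParticle lennardJones := by
  intro hfin t ht
  obtain ⟨κ, hκ, s, hs, hgap⟩ := hfin (t / 2) (half_pos ht)
  refine ⟨κ, hκ, s / 2, half_pos hs, fun Q hgood hbad => le_of_forall_pos_le_add fun ε hε => ?_⟩
  have hF : (0 : ℝ) < Q.motif.card := by exact_mod_cast Q.motif_nonempty.card_pos
  -- blocks are trial states with slack `ε` per particle
  obtain ⟨K₀, hK₀, hK⟩ := exists_block_energy_le Q hε
  -- a large `K`: beyond `K₀`, beyond `12 · depth`, and with `12 · depth ≤ s · K`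
  set d := depth Q 2
  obtain ⟨K₁, hK₁⟩ := exists_nat_gt (12 * (d : ℝ) / s)
  set K := max K₀ (max (12 * d) K₁)
  have hKK₀ : K₀ ≤ K := le_max_left _ _
  have hK12 : 12 * d ≤ K := (le_max_left _ _).trans (le_max_right _ _)
  have hKK₁ : K₁ ≤ K := (le_max_right _ _).trans (le_max_right _ _)
  have hKpos : (0 : ℝ) < K := by exact_mod_cast lt_of_lt_of_le hK₀ hKK₀
  have hK12r : 12 * (d : ℝ) ≤ K := by exact_mod_cast hK12
  have hK1r : (K₁ : ℝ) ≤ K := by exact_mod_cast hKK₁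
  have hsK : 12 * (d : ℝ) ≤ s * K := by
    have h := (div_lt_iff₀ hs).1 (hK₁.trans_le hK1r)
    linarith
  have hn : ((Fintype.card (BIdx Q K) : ℕ) : ℝ) = Q.motif.card * (K : ℝ) ^ 3 := by
    exact_mod_cast card_BIdx Q K
  -- the energy of the block
  have hE := hK K hKK₀
  rw [hn] at hE
  -- badly-shelled block points: at least `(K³ − 6·d·K²) · t · #F ≥ (t/2) · #F · K³`
  have hcnt := card_bad_block_ge Q K
  have hdeep := card_deep_ge K d
  set D := Nat.card {k : Fin 3 → Fin K // IsDeep K d k}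
  set M := Nat.card {x : Q.motif // ¬ GoodShell ((Measure.count : Measure E3).restrict
    ((fun z => z - (x : E3)) '' Q.points))}
  set B := Nat.card {a : Fin (Fintype.card (BIdx Q K)) // ¬ GoodShell ((Measure.count : Measure E3).restrict
    ((fun z => z - blockConfig Q K a) '' Set.range (blockConfig Q K)))}
  have h1 : (K : ℝ) ^ 3 - 6 * (d : ℝ) * (K : ℝ) ^ 2 ≤ (D : ℝ) := by
    have := (Nat.cast_le (α := ℝ)).2 hdeep
    push_cast at this
    linarith
  have h2 : (D : ℝ) * (M : ℝ) ≤ (B : ℝ) := by exact_mod_cast hcnt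
  have hM0 : (0 : ℝ) ≤ M := Nat.cast_nonneg _
  have hhalf : 6 * (d : ℝ) * (K : ℝ) ^ 2 ≤ (K : ℝ) ^ 3 / 2 := by
    have h := mul_le_mul_of_nonneg_right hK12r (sq_nonneg (K : ℝ))
    have e : (K : ℝ) * (K : ℝ) ^ 2 = (K : ℝ) ^ 3 := by ring
    rw [e] at h
    linarith
  have hMK : t * (Q.motif.card : ℝ) * ((K : ℝ) ^ 3 / 2) ≤ (M : ℝ) * ((K : ℝ) ^ 3 / 2) :=
    mul_le_mul_of_nonneg_right hbad (div_nonneg (pow_nonneg hKpos.le 3) zero_le_two)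
  have hMD : (M : ℝ) * ((K : ℝ) ^ 3 / 2) ≤ (M : ℝ) * (D : ℝ) :=
    mul_le_mul_of_nonneg_left (by linarith) hM0
  have hthr : t / 2 * (Q.motif.card * (K : ℝ) ^ 3) ≤ (B : ℝ) := by
    calc t / 2 * (Q.motif.card * (K : ℝ) ^ 3) = t * (Q.motif.card : ℝ) * ((K : ℝ) ^ 3 / 2) := by ring
      _ ≤ (M : ℝ) * ((K : ℝ) ^ 3 / 2) := hMK
      _ ≤ (M : ℝ) * (D : ℝ) := hMD
      _ = (D : ℝ) * (M : ℝ) := mul_comm _ _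
      _ ≤ (B : ℝ) := h2
  -- block points not `SetGood`: at most `(s/2)·#F·K³ + #F·6·d·K² ≤ s · #F · K³`
  have hG := card_notSetGood_block_le Q K
  set G := Nat.card {a : Fin (Fintype.card (BIdx Q K)) //
    ¬ SetGood (Set.range (blockConfig Q K)) (blockConfig Q K a)}
  set M' := Nat.card {x : Q.motif // ¬ SetGood Q.points (x : E3)}
  have h3 : (G : ℝ) ≤ (M' : ℝ) * (K : ℝ) ^ 3 + Q.motif.card * (6 * (d : ℝ) * (K : ℝ) ^ 2) := by
    exact_mod_cast hG
  have hM'K : (M' : ℝ) * (K : ℝ) ^ 3 ≤ s / 2 * (Q.motif.card : ℝ) * (K : ℝ) ^ 3 :=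
    mul_le_mul_of_nonneg_right hgood (pow_nonneg hKpos.le 3)
  have hrest : Q.motif.card * (6 * (d : ℝ) * (K : ℝ) ^ 2) ≤ s / 2 * (Q.motif.card : ℝ) * (K : ℝ) ^ 3 := by
    have h := mul_le_mul_of_nonneg_right hsK (sq_nonneg (K : ℝ))
    have e : s * (K : ℝ) * (K : ℝ) ^ 2 = s * (K : ℝ) ^ 3 := by ring
    rw [e] at h
    have h' : 6 * (d : ℝ) * (K : ℝ) ^ 2 ≤ s / 2 * (K : ℝ) ^ 3 := by linarith
    calc Q.motif.card * (6 * (d : ℝ) * (K : ℝ) ^ 2) ≤ Q.motif.card * (s / 2 * (K : ℝ) ^ 3) :=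
          mul_le_mul_of_nonneg_left h' hF.le
      _ = s / 2 * (Q.motif.card : ℝ) * (K : ℝ) ^ 3 := by ring
  have hbud : (G : ℝ) ≤ s * (Q.motif.card * (K : ℝ) ^ 3) := by
    calc (G : ℝ) ≤ (M' : ℝ) * (K : ℝ) ^ 3 + Q.motif.card * (6 * (d : ℝ) * (K : ℝ) ^ 2) := h3
      _ ≤ s / 2 * (Q.motif.card : ℝ) * (K : ℝ) ^ 3 + s / 2 * (Q.motif.card : ℝ) * (K : ℝ) ^ 3 :=
          add_le_add hM'K hrest
      _ = s * (Q.motif.card * (K : ℝ) ^ 3) := by ring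
  -- the finite gap on the block
  have hg := hgap _ (blockConfig Q K) (blockConfig_injective Q K)
  rw [hn] at hg
  have key := (hg hbud hthr).trans hE
  have hK3 : (0 : ℝ) < Q.motif.card * (K : ℝ) ^ 3 := mul_pos hF (pow_pos hKpos 3)
  exact le_of_mul_le_mul_left key hK3

end Summit.AtomisticToContinuum.Crystallization.Theorems.PalmGoodLaw.FunnelPeriodicGapConverse

end
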